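import Literature.NumberTheory.GaloisRepresentations.RamificationCertificatesProofs
import Mathlib.NumberTheory.RamificationInertia.Basic
import HarnessLib

/-!
# The degree of an explicit field from ramification certificates: `2k ≤ e f ≤ [L : K]`

`Proofs` file (theorems only, no definitions, no named facts) in topic
`NumberTheory/GaloisRepresentations`, landed by the seat of bsd.S15
(`Literature.NumberTheory.EllipticCurves.conductorNorm_eq_artinConductorNat_of_isElliptic`): the
step of the explicit-field route that replaces an irreducibility proof of a degree-`2k` defining
polynomial.  For a prime `𝔔 ≠ 0` of `S = \bar R^L` over `𝔭 = 𝔔 ∩ R` with `#(R/𝔭) = 2`: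

* `mul_ord_eq_ramificationIdx_of_pow_eq` (certificate `d ϖ^k = p n`, `v_𝔭(p) = 1`) gives
  `e(𝔔 ∣ 𝔭) = k v_𝔔(ϖ) ≥ k` (`ramificationIdx_ge_of_pow_eq`);
* an `ω ∈ S` with `ω, ω - 1 ∉ 𝔔` gives **`f(𝔔 ∣ 𝔭) ≥ 2`** (`two_le_inertiaDeg_of_notMem`: `S/𝔔` has
  the three distinct elements `0, 1, ω̄`, and `#(S/𝔔) = 2^f`);
* hence **`2k ≤ e f ≤ [L : K]`** (`two_mul_le_finrank_of_certificates`, the fundamental identity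
  `Σ eᵢ fᵢ = [L : K]`, Mathlib `Ideal.sum_ramification_inertia`), and if `[L : K] ≤ 2k` (e.g.
  `L = K(β)` with `β` a root of a polynomial of degree `2k`) then `[L : K] = 2k`, `e = k`, `f = 2`,
  `v_𝔔(ϖ) = 1` (`finrank_eq_of_certificates`) — in particular the defining polynomial was
  irreducible and `𝔔` is the only prime above `𝔭` (`e f = [L : K]`).

## References

* J.-P. Serre, *Local Fields*, GTM 67 (1979), Ch. I §4 Prop. 10 (`Σ eᵢ fᵢ = n`), §6 Prop. 17–18.
  [SerreLocalFields1979]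

## Design

Theorems only; setting of `RamificationCertificatesProofs` (`R` Dedekind with fraction field `K`,
`L/K` finite Galois, `𝔔` maximal in `integralClosure R L`).  Axioms: `propext`,
`Classical.choice`, `Quot.sound`.
-/

noncomputable section

open scoped Classical Pointwise

namespace Literature.NumberTheory.GaloisRepresentations

variable (R : Type*) {K L : Type*} [CommRing R] [IsDedekindDomain R] [Field K] [Field L]
  [Algebra R K] [IsFractionRing R K] [Algebra R L] [Algebra K L] [IsScalarTower R K L]
  [FiniteDimensional K L] [IsGalois K L]
  (𝔓 : Ideal (integralClosure R L)) [𝔓.IsMaximal]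

variable {R}

include K in
/-- **`e ≥ k` from a ramification certificate** `d ϖ^k = p n` (`d, n ∉ 𝔔`, `v_𝔭(p) = 1`): indeed
`e = k v_𝔔(ϖ)` with `v_𝔔(ϖ) ≥ 1` (`e ≠ 0`). [cite: SerreLocalFields1979, Ch. I §6 Prop. 17–18] -/
theorem ramificationIdx_ge_of_pow_eq (h𝔓 : 𝔓 ≠ ⊥) {d ϖ n : integralClosure R L} {p : R} {k : ℕ}
    (h : d * ϖ ^ k = algebraMap R _ p * n) (hd : d ∉ 𝔓) (hn : n ∉ 𝔓) (hp : p ∈ 𝔓.under R)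
    (hp2 : p ∉ (𝔓.under R) ^ 2) : k ≤ (𝔓.under R).ramificationIdx' 𝔓 := by
  haveI : IsDedekindDomain (integralClosure R L) := integralClosure.isDedekindDomain R K L
  have key := mul_ord_eq_ramificationIdx_of_pow_eq (K := K) 𝔓 h𝔓 h hd hn hp hp2
  -- `e ≥ 1`
  have he1 : 1 ≤ (𝔓.under R).ramificationIdx' 𝔓 := by
    haveI : 𝔓.LiesOver (𝔓.under R) := ⟨rfl⟩
    haveI := faithfulSMul_integralClosure R (K := K) (L := L)
    haveI : Module.Finite R (integralClosure R L) :=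
      IsIntegralClosure.finite R K L (integralClosure R L)
    haveI : Module.IsTorsionFree R (integralClosure R L) := by
      rw [Module.isTorsionFree_iff_faithfulSMul]; infer_instance
    have hp0 : 𝔓.under R ≠ ⊥ := Ideal.IsIntegral.comap_ne_bot _ h𝔓
    exact Nat.one_le_iff_ne_zero.mpr (Ideal.IsDedekindDomain.ramificationIdx'_ne_zero
      (Ideal.map_ne_bot_of_ne_bot hp0) inferInstance (Ideal.map_le_iff_le_comap.mpr le_rfl))
  by_cases hϖ : ϖ = 0
  · subst hϖ
    by_cases hk : k = 0
    · rw [hk]; exact Nat.zero_le _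
    · rw [ord_zero, ENat.mul_top (by exact_mod_cast hk)] at key
      exact absurd key.symm (ENat.coe_ne_top _)
  obtain ⟨m, hm⟩ := exists_ord_eq_natCast 𝔓 h𝔓 hϖ
  rw [hm] at key
  have key' : k * m = (𝔓.under R).ramificationIdx' 𝔓 := by exact_mod_cast key
  have hm1 : 1 ≤ m := by
    by_contra h0
    push Not at h0
    interval_cases m
    omega
  nlinarith

include K in
/-- **`f ≥ 2` from a residue certificate**: if `#(R/𝔭) = 2` and `ω ∈ S` has `ω ∉ 𝔔`, `ω - 1 ∉ 𝔔`,
then the residue field `S/𝔔` has at least the three elements `0, 1, ω̄`, so `#(S/𝔔) = 2^f ≥ 3`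
and `f(𝔔 ∣ 𝔭) ≥ 2`. [cite: SerreLocalFields1979, Ch. I §4 (residue degree)] -/
theorem two_le_inertiaDeg_of_notMem (hq : Nat.card (R ⧸ 𝔓.under R) = 2)
    {ω : integralClosure R L} (hω : ω ∉ 𝔓) (hω1 : ω - 1 ∉ 𝔓) :
    2 ≤ (𝔓.under R).inertiaDeg' 𝔓 := by
  haveI : IsDedekindDomain (integralClosure R L) := integralClosure.isDedekindDomain R K L
  haveI : 𝔓.LiesOver (𝔓.under R) := ⟨rfl⟩
  haveI : (𝔓.under R).IsMaximal := Ideal.IsMaximal.under R 𝔓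
  letI : Field (R ⧸ 𝔓.under R) := Ideal.Quotient.field _
  letI : Field (integralClosure R L ⧸ 𝔓) := Ideal.Quotient.field _
  rw [Ideal.inertiaDeg'_algebraMap]
  -- the residue field of `R` is finite with two elements, so `S/𝔓` is finite with `2^f` elements
  haveI : Finite (R ⧸ 𝔓.under R) := Nat.finite_of_card_ne_zero (by rw [hq]; norm_num)
  haveI : Module.Finite R (integralClosure R L) :=
    IsIntegralClosure.finite R K L (integralClosure R L)
  haveI : Module.Finite (R ⧸ 𝔓.under R) (integralClosure R L ⧸ 𝔓) :=
    module_finite_of_liesOver 𝔓 (𝔓.under R)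
  have hcard := Module.natCard_eq_pow_finrank (K := R ⧸ 𝔓.under R) (V := integralClosure R L ⧸ 𝔓)
  rw [hq] at hcard
  -- three distinct residues `0, 1, ω̄`
  haveI : Finite (integralClosure R L ⧸ 𝔓) := Module.finite_of_finite (R ⧸ 𝔓.under R)
  haveI := Fintype.ofFinite (integralClosure R L ⧸ 𝔓)
  have h10 : (1 : integralClosure R L ⧸ 𝔓) ≠ 0 := one_ne_zero
  have hω0 : Ideal.Quotient.mk 𝔓 ω ≠ 0 := fun h ↦ hω (Ideal.Quotient.eq_zero_iff_mem.mp h)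
  have hω1' : Ideal.Quotient.mk 𝔓 ω ≠ 1 := fun h ↦ hω1 (by
    rw [← map_one (Ideal.Quotient.mk 𝔓), Ideal.Quotient.eq] at h; exact h)
  have h3 : 3 ≤ Nat.card (integralClosure R L ⧸ 𝔓) := by
    have hc : ({0, 1, Ideal.Quotient.mk 𝔓 ω} : Finset (integralClosure R L ⧸ 𝔓)).card = 3 := by
      rw [Finset.card_insert_of_notMem, Finset.card_insert_of_notMem, Finset.card_singleton]
      · simp only [Finset.mem_singleton]; exact fun h ↦ hω1' h.symm
      · simp only [Finset.mem_insert, Finset.mem_singleton, not_or]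
        exact ⟨h10.symm, fun h ↦ hω0 h.symm⟩
    rw [Nat.card_eq_fintype_card, ← hc]
    exact Finset.card_le_univ _
  rw [hcard] at h3
  -- `2^f ≥ 3` forces `f ≥ 2`
  by_contra hf
  push Not at hf
  have : 2 ^ Module.finrank (R ⧸ 𝔓.under R) (integralClosure R L ⧸ 𝔓) ≤ 2 ^ 1 :=
    Nat.pow_le_pow_right (by norm_num) (by omega)
  omega

include K in
/-- **`2k ≤ [L : K]` from the two certificates** (`e ≥ k`, `f ≥ 2`, and `e f ≤ Σ eᵢ fᵢ = [L : K]`).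
[cite: SerreLocalFields1979, Ch. I §4 Prop. 10 and §6 Prop. 17–18] -/
theorem two_mul_le_finrank_of_certificates (h𝔓 : 𝔓 ≠ ⊥) (hq : Nat.card (R ⧸ 𝔓.under R) = 2)
    {ω : integralClosure R L} (hω : ω ∉ 𝔓) (hω1 : ω - 1 ∉ 𝔓)
    {d ϖ n : integralClosure R L} {p : R} {k : ℕ} (h : d * ϖ ^ k = algebraMap R _ p * n)
    (hd : d ∉ 𝔓) (hn : n ∉ 𝔓) (hp : p ∈ 𝔓.under R) (hp2 : p ∉ (𝔓.under R) ^ 2) :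
    2 * k ≤ Module.finrank K L ∧
      (𝔓.under R).ramificationIdx' 𝔓 * (𝔓.under R).inertiaDeg' 𝔓 ≤ Module.finrank K L := by
  haveI : IsDedekindDomain (integralClosure R L) := integralClosure.isDedekindDomain R K L
  haveI : 𝔓.LiesOver (𝔓.under R) := ⟨rfl⟩
  haveI : (𝔓.under R).IsMaximal := Ideal.IsMaximal.under R 𝔓
  haveI := faithfulSMul_integralClosure R (K := K) (L := L)
  haveI : Module.Finite R (integralClosure R L) :=
    IsIntegralClosure.finite R K L (integralClosure R L)
  haveI : IsFractionRing (integralClosure R L) L :=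
    IsIntegralClosure.isFractionRing_of_finite_extension R K L (integralClosure R L)
  have hp0 : 𝔓.under R ≠ ⊥ := Ideal.IsIntegral.comap_ne_bot _ h𝔓
  have he := ramificationIdx_ge_of_pow_eq (K := K) 𝔓 h𝔓 h hd hn hp hp2
  have hf := two_le_inertiaDeg_of_notMem (K := K) 𝔓 hq hω hω1
  -- one term of the fundamental identity
  have hmem : 𝔓 ∈ IsDedekindDomain.primesOverFinset (𝔓.under R) (integralClosure R L) :=
    (IsDedekindDomain.mem_primesOverFinset_iff hp0 _).mpr ⟨inferInstance, inferInstance⟩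
  have hsum := _root_.Ideal.sum_ramification_inertia (integralClosure R L) K L hp0
  have hterm : (𝔓.under R).ramificationIdx' 𝔓 * (𝔓.under R).inertiaDeg' 𝔓 ≤ Module.finrank K L := by
    rw [← hsum]
    exact Finset.single_le_sum (f := fun P ↦ (𝔓.under R).ramificationIdx' P *
      (𝔓.under R).inertiaDeg' P) (fun _ _ ↦ Nat.zero_le _) hmem
  refine ⟨le_trans ?_ hterm, hterm⟩
  calc 2 * k = k * 2 := mul_comm _ _
    _ ≤ (𝔓.under R).ramificationIdx' 𝔓 * (𝔓.under R).inertiaDeg' 𝔓 := Nat.mul_le_mul he hf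

include K in
/-- **The degree, the ramification and the uniformizer from certificates.**  If moreover
`[L : K] ≤ 2k` then `[L : K] = 2k`, `e(𝔔 ∣ 𝔭) = k`, `f(𝔔 ∣ 𝔭) = 2` and `v_𝔔(ϖ) = 1` (so `e f = [L : K]`:
`𝔔` is the only prime of `L` above `𝔭`, and a defining polynomial of degree `2k` was irreducible).
[cite: SerreLocalFields1979, Ch. I §4 Prop. 10 and §6 Prop. 17–18] -/
theorem finrank_eq_of_certificates (h𝔓 : 𝔓 ≠ ⊥) (hq : Nat.card (R ⧸ 𝔓.under R) = 2)
    {ω : integralClosure R L} (hω : ω ∉ 𝔓) (hω1 : ω - 1 ∉ 𝔓)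
    {d ϖ n : integralClosure R L} {p : R} {k : ℕ} (hk : 0 < k)
    (h : d * ϖ ^ k = algebraMap R _ p * n)
    (hd : d ∉ 𝔓) (hn : n ∉ 𝔓) (hp : p ∈ 𝔓.under R) (hp2 : p ∉ (𝔓.under R) ^ 2)
    (hdeg : Module.finrank K L ≤ 2 * k) :
    Module.finrank K L = 2 * k ∧ (𝔓.under R).ramificationIdx' 𝔓 = k ∧
      (𝔓.under R).inertiaDeg' 𝔓 = 2 ∧ ord 𝔓 ϖ = 1 := by
  haveI : IsDedekindDomain (integralClosure R L) := integralClosure.isDedekindDomain R K L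
  obtain ⟨h2k, hterm⟩ := two_mul_le_finrank_of_certificates (K := K) 𝔓 h𝔓 hq hω hω1 h hd hn hp hp2
  have he := ramificationIdx_ge_of_pow_eq (K := K) 𝔓 h𝔓 h hd hn hp hp2
  have hf := two_le_inertiaDeg_of_notMem (K := K) 𝔓 hq hω hω1
  have hn' : Module.finrank K L = 2 * k := le_antisymm hdeg h2k
  -- `e f ≤ 2k`, `e ≥ k`, `f ≥ 2` force `e = k`, `f = 2`
  have hef : (𝔓.under R).ramificationIdx' 𝔓 * (𝔓.under R).inertiaDeg' 𝔓 ≤ 2 * k := hn' ▸ hterm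
  have he' : (𝔓.under R).ramificationIdx' 𝔓 = k := by
    have : (𝔓.under R).ramificationIdx' 𝔓 * 2 ≤ 2 * k := le_trans (Nat.mul_le_mul_left _ hf) hef
    omega
  have hf' : (𝔓.under R).inertiaDeg' 𝔓 = 2 := by
    rw [he'] at hef
    have : k * (𝔓.under R).inertiaDeg' 𝔓 ≤ k * 2 := by linarith
    exact le_antisymm (Nat.le_of_mul_le_mul_left this hk) hf
  refine ⟨hn', he', hf', ?_⟩
  exact (ord_eq_one_and_ramificationIdx_eq (K := K) 𝔓 h𝔓 hk h hd hn hp hp2 he'.le).1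

end Literature.NumberTheory.GaloisRepresentations

end
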